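import Mathlib.Analysis.InnerProductSpace.LaxMilgram
import Mathlib.Analysis.InnerProductSpace.Projection.Submodule
import Mathlib.Analysis.Analytic.Constructions
import Mathlib.Analysis.Analytic.Linear
import HarnessLib

/-!
# Analytic dependence of a coercive quadratic minimum on its coefficients (Kato VII-§4)

Analysis/OperatorTheory proofs-layer file (theorems only, no definitions, no named facts).

Let `H` be a real Hilbert space, `K ≤ H` a (not necessarily closed) submodule, `b : H`, and
`T : P → (H →L[ℝ] H)` a family of bounded symmetric operators on `H`, analytic at `p₀` as a map
from a real normed space `P` into the operator-norm algebra, with `T p₀` coercive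
(`c ‖v‖² ≤ ⟪T p₀ v, v⟫`). Then the constrained minimum of the quadratic form,

  `E(p) = inf { ⟪T p (b + k), b + k⟫ : k ∈ K }`,

is a real-analytic function of `p` at `p₀` (`analyticAt_sInf_quadratic`). This is the
bounded-symmetric special case of the mechanism of Kato's analytic perturbation theory for
families of sectorial forms (T. Kato, *Perturbation Theory for Linear Operators* (1966),
Ch. VII §4 "Holomorphic families of type (B)": the operators associated with an analytic family of
closed sectorial forms, and their inverses, depend analytically on the parameter), written for the
Dirichlet-principle computation of conformal moduli (the energy minimum over an affine space of
test functions, as a function of the coefficient matrix).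

Proof. (1) Coercivity is an open condition in operator norm (`eventually_coercive`). (2) A
coercive bounded operator on a real Hilbert space is a unit — Lax–Milgram, Mathlib's
`IsCoercive.continuousLinearEquivOfBilin` (`isUnit_of_coercive`). (3) Completing the square
(`sInf_quadratic_eq`): with `V` the closure of `K`, `P_V` the orthogonal projection,
`S = P_V ∘ A ∘ ι_V` the compression (coercive, hence a unit) and `w = P_V (A b)`, for `k ∈ V`
`⟪A (b + k), b + k⟫ = ⟪A b, b⟫ − ⟪S⁻¹ w, w⟫ + ⟪A (k − k⋆), k − k⋆⟫` with `k⋆ = −S⁻¹ w`, so the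
infimum over `K` (dense in `V`) is `⟪A b, b⟫ − ⟪S⁻¹ w, w⟫`. (4) In this formula `p ↦ S p`,
`p ↦ w p` are analytic (bounded bilinear maps, `ContinuousLinearMap.analyticAt_bilinear`) and
`Ring.inverse` is analytic at units (`analyticAt_inverse`), whence `E` is analytic near `p₀`.

## References

* T. Kato, *Perturbation Theory for Linear Operators*, Grundlehren 132, Springer (1966),
  Ch. VI §2 (representation of closed sectorial forms, the first representation theorem) and
  Ch. VII §4 (holomorphic families of forms of type (B); analyticity of the associated operators
  and resolvents). [Kato1966]
-/

noncomputable section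

namespace Literature.Analysis.OperatorTheory

open _root_.Filter _root_.Set
open scoped InnerProductSpace

variable {P : Type*} [NormedAddCommGroup P] [NormedSpace ℝ P]
variable {H : Type*} [NormedAddCommGroup H] [InnerProductSpace ℝ H]

omit [NormedSpace ℝ P] in
/-- **Coercivity is open.** If `T` is continuous at `p₀` (operator norm) and `T p₀` is coercive
with constant `c`, then `T p` is coercive with constant `c / 2` for `p` near `p₀`
(`|⟪(T p − T p₀) v, v⟫| ≤ ‖T p − T p₀‖ ‖v‖²`). [folklore] -/
theorem eventually_coercive (T : P → H →L[ℝ] H) (p₀ : P) (hT : ContinuousAt T p₀)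
    {c : ℝ} (hc : 0 < c) (h : ∀ v, c * ‖v‖ ^ 2 ≤ ⟪T p₀ v, v⟫_ℝ) :
    ∀ᶠ p in nhds p₀, ∀ v, (c / 2) * ‖v‖ ^ 2 ≤ ⟪T p v, v⟫_ℝ := by
  have hev : ∀ᶠ p in nhds p₀, dist (T p) (T p₀) < c / 2 :=
    Metric.tendsto_nhds.1 hT (c / 2) (by positivity)
  filter_upwards [hev] with p hp v
  rw [dist_eq_norm] at hp
  have h1 := h v
  have h2 : ⟪T p v, v⟫_ℝ = ⟪T p₀ v, v⟫_ℝ + ⟪(T p - T p₀) v, v⟫_ℝ := by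
    rw [sub_apply, inner_sub_left]; ring
  have h3 : |⟪(T p - T p₀) v, v⟫_ℝ| ≤ ‖T p - T p₀‖ * ‖v‖ ^ 2 :=
    calc |⟪(T p - T p₀) v, v⟫_ℝ| ≤ ‖(T p - T p₀) v‖ * ‖v‖ := abs_real_inner_le_norm _ _
      _ ≤ (‖T p - T p₀‖ * ‖v‖) * ‖v‖ := by
          gcongr; exact ContinuousLinearMap.le_opNorm _ _
      _ = ‖T p - T p₀‖ * ‖v‖ ^ 2 := by ring
  have h4 : ‖T p - T p₀‖ * ‖v‖ ^ 2 ≤ (c / 2) * ‖v‖ ^ 2 := by gcongr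
  have h5 := (abs_le.1 h3).1
  rw [h2]; linarith

/-- **Lax–Milgram, unit form.** A coercive bounded operator `S` on a real Hilbert space
(`c ‖v‖² ≤ ⟪S v, v⟫`, `c > 0`) is a unit of the operator algebra: the Lax–Milgram equivalence of
the coercive bilinear form `⟪S ·, ·⟫` (`IsCoercive.continuousLinearEquivOfBilin`) is `S` itself.
[folklore] -/
theorem isUnit_of_coercive {V : Type*} [NormedAddCommGroup V] [InnerProductSpace ℝ V]
    [CompleteSpace V] (S : V →L[ℝ] V) {c : ℝ} (hc : 0 < c)
    (h : ∀ v, c * ‖v‖ ^ 2 ≤ ⟪S v, v⟫_ℝ) : IsUnit S := by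
  set B : V →L[ℝ] V →L[ℝ] ℝ := (innerSL ℝ).comp S with hB_def
  have hB : IsCoercive B := ⟨c, hc, fun u => by simpa [B, sq, mul_assoc] using h u⟩
  have hA : (hB.continuousLinearEquivOfBilin : V →L[ℝ] V) = S := by
    ext v
    refine ext_inner_right ℝ fun w => ?_
    rw [ContinuousLinearEquiv.coe_coe, hB.continuousLinearEquivOfBilin_apply]
    simp [B]
  exact ⟨hB.continuousLinearEquivOfBilin.toUnit, hA⟩

/-- **Completing the square** (Kato VI-§2 / VII-§4 mechanism, bounded symmetric coercive case).
For `A` symmetric and coercive on the real Hilbert space `H`, `K ≤ V` submodules with `V`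
complete and contained in the closure of `K`, and `b : H`: with `P_V` the orthogonal projection,
`S = P_V ∘ A ∘ ι_V` and `w = P_V (A b)`,
`inf {⟪A (b + k), b + k⟫ : k ∈ K} = ⟪A b, b⟫ − ⟪S⁻¹ w, w⟫` (`S⁻¹ = Ring.inverse S`, `S` being a
unit by Lax–Milgram); the infimum over `K` equals the minimum over `V`, attained at
`k⋆ = −S⁻¹ w`. [cite: Kato1966, Ch. VI §2] -/
theorem sInf_quadratic_eq (K V : Submodule ℝ H) [CompleteSpace V] (hKV : K ≤ V)
    (hVK : (V : Set H) ⊆ closure K) (A : H →L[ℝ] H)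
    (hsym : ∀ u v, ⟪A u, v⟫_ℝ = ⟪u, A v⟫_ℝ) {c : ℝ} (hc : 0 < c)
    (hco : ∀ v, c * ‖v‖ ^ 2 ≤ ⟪A v, v⟫_ℝ) (b : H) :
    sInf {e : ℝ | ∃ k ∈ K, e = ⟪A (b + k), b + k⟫_ℝ} =
      ⟪A b, b⟫_ℝ - ⟪Ring.inverse (V.orthogonalProjectionOnto ∘L A ∘L V.subtypeL)
        (V.orthogonalProjectionOnto (A b)), V.orthogonalProjectionOnto (A b)⟫_ℝ := by
  set Pv := V.orthogonalProjectionOnto with hPv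
  set S : V →L[ℝ] V := Pv ∘L A ∘L V.subtypeL with hS_def
  set w : V := Pv (A b) with hw_def
  have hSinner : ∀ u v : V, ⟪S u, v⟫_ℝ = ⟪A u, v⟫_ℝ := fun u v => by
    simp [S, Pv]
  have hS : ∀ v : V, c * ‖v‖ ^ 2 ≤ ⟪S v, v⟫_ℝ := fun v => by
    rw [hSinner]; simpa using hco v
  obtain ⟨u, hu⟩ := isUnit_of_coercive S hc hS
  set kstar : V := -(Ring.inverse S w) with hk_def
  have hSk : S kstar = -w := by
    rw [hk_def, map_neg, ← hu, Ring.inverse_unit, ← mul_apply_eq_comp, Units.mul_inv,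
      one_apply_eq_self]
  have key : ∀ v : V, ⟪A kstar, v⟫_ℝ = -⟪A b, v⟫_ℝ := fun v => by
    rw [← hSinner, hSk, inner_neg_left]
    simp [w, Pv]
  have iden : ∀ k : H, k ∈ V → ⟪A (b + k), b + k⟫_ℝ =
      (⟪A b, b⟫_ℝ + ⟪A b, kstar⟫_ℝ) + ⟪A (k - kstar), k - kstar⟫_ℝ := by
    intro k hk
    have e1 : ⟪A kstar, k⟫_ℝ = -⟪A b, k⟫_ℝ := key ⟨k, hk⟩
    have e2 : ⟪A kstar, kstar⟫_ℝ = -⟪A b, kstar⟫_ℝ := key kstar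
    have e3 : ⟪A k, b⟫_ℝ = ⟪A b, k⟫_ℝ := by rw [hsym, real_inner_comm]
    have e4 : ⟪A k, (kstar : H)⟫_ℝ = ⟪A kstar, k⟫_ℝ := by rw [hsym, real_inner_comm]
    simp only [map_add, map_sub, inner_add_left, inner_add_right, inner_sub_left,
      inner_sub_right]
    linarith
  have hm : ⟪A b, (kstar : H)⟫_ℝ = -⟪Ring.inverse S w, w⟫_ℝ := by
    have : ⟪A b, (kstar : H)⟫_ℝ = ⟪w, kstar⟫_ℝ := by simp [w, Pv]
    rw [this, hk_def, inner_neg_right, real_inner_comm]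
  set E := {e : ℝ | ∃ k ∈ K, e = ⟪A (b + k), b + k⟫_ℝ} with hE
  set m := ⟪A b, b⟫_ℝ + ⟪A b, kstar⟫_ℝ with hm_def
  have lb : ∀ e ∈ E, m ≤ e := by
    rintro _ ⟨k, hk, rfl⟩
    rw [iden k (hKV hk)]
    have h1 := hco (k - kstar)
    have h2 : 0 ≤ c * ‖k - (kstar : H)‖ ^ 2 := by positivity
    linarith
  have hne : E.Nonempty := ⟨_, 0, K.zero_mem, rfl⟩
  have hmem : m ∈ closure E := by
    have hcont : Continuous fun k : H => ⟪A (b + k), b + k⟫_ℝ := by fun_prop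
    have hk : (kstar : H) ∈ closure (K : Set H) := hVK kstar.2
    have h1 : ⟪A (b + kstar), b + kstar⟫_ℝ ∈ closure E :=
      map_mem_closure (f := fun k : H => ⟪A (b + k), b + k⟫_ℝ) (t := E) hcont hk
        (fun k hk => ⟨k, hk, rfl⟩)
    have h2 : ⟪A (b + kstar), b + kstar⟫_ℝ = m := by
      rw [iden kstar kstar.2]; simp [m]
    rwa [h2] at h1
  have hinf : sInf E = m := by
    apply le_antisymm
    · by_contra hlt
      push Not at hlt
      obtain ⟨e, he, hd⟩ := Metric.mem_closure_iff.1 hmem (sInf E - m) (by linarith)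
      have h1 := csInf_le ⟨m, lb⟩ he
      rw [Real.dist_eq] at hd
      linarith [(abs_lt.1 hd).1, (abs_lt.1 hd).2]
    · exact le_csInf hne lb
  rw [hinf, hm_def, hm]; ring

/-- **Analyticity of a coercive quadratic minimum in its coefficients** (Kato 1966, Ch. VII §4,
analytic families of forms: bounded symmetric coercive special case). `H` a real Hilbert space,
`K ≤ H` any submodule, `b : H`, `T : P → (H →L[ℝ] H)` analytic at `p₀` with every `T p` symmetric
and `T p₀` coercive; then `p ↦ inf {⟪T p (b + k), b + k⟫ : k ∈ K}` is real-analytic at `p₀`.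
Proof: near `p₀` it equals `⟪T p b, b⟫ − ⟪Ring.inverse (S p) (w p), w p⟫`
(`sInf_quadratic_eq` on the closure of `K`, `eventually_coercive`), analytic by
`ContinuousLinearMap.analyticAt_bilinear` and `analyticAt_inverse`. [cite: Kato1966, Ch. VII §4] -/
theorem analyticAt_sInf_quadratic [CompleteSpace H] (K : Submodule ℝ H) (b : H)
    (T : P → H →L[ℝ] H) (p₀ : P) (hT : AnalyticAt ℝ T p₀)
    (hsym : ∀ p u v, ⟪T p u, v⟫_ℝ = ⟪u, T p v⟫_ℝ)
    (hc : ∃ c : ℝ, 0 < c ∧ ∀ v, c * ‖v‖ ^ 2 ≤ ⟪T p₀ v, v⟫_ℝ) :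
    AnalyticAt ℝ (fun p => sInf {e : ℝ | ∃ k ∈ K, e = ⟪T p (b + k), b + k⟫_ℝ}) p₀ := by
  obtain ⟨c, hc, hco⟩ := hc
  let V := K.topologicalClosure
  let Pv := V.orthogonalProjectionOnto
  let S : P → V →L[ℝ] V := fun p => Pv ∘L T p ∘L V.subtypeL
  let w : P → V := fun p => Pv (T p b)
  have hS : AnalyticAt ℝ S p₀ := by
    have h1 : AnalyticAt ℝ (fun p => T p ∘L V.subtypeL) p₀ := by
      have := ((ContinuousLinearMap.compL ℝ V H H).analyticAt_bilinear
        (T p₀, V.subtypeL)).comp₂ hT analyticAt_const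
      simpa using this
    have := ((ContinuousLinearMap.compL ℝ V H V).analyticAt_bilinear
        (Pv, T p₀ ∘L V.subtypeL)).comp₂ analyticAt_const h1
    simpa using this
  have hTb : AnalyticAt ℝ (fun p => T p b) p₀ := by
    have := ((ContinuousLinearMap.apply ℝ H b).analyticAt _).comp hT
    simpa [Function.comp_def] using this
  have hw : AnalyticAt ℝ w p₀ := (Pv.analyticAt _).comp hTb
  have hinv : AnalyticAt ℝ (fun p => Ring.inverse (S p)) p₀ := by
    obtain ⟨u, hu⟩ : IsUnit (S p₀) := isUnit_of_coercive (S p₀) hc (fun v => by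
      have : ⟪S p₀ v, v⟫_ℝ = ⟪T p₀ v, v⟫_ℝ := by simp [S, Pv]
      rw [this]; simpa using hco v)
    have := analyticAt_inverse (𝕜 := ℝ) (A := V →L[ℝ] V) u
    rw [hu] at this
    exact this.comp hS
  have hRw : AnalyticAt ℝ (fun p => Ring.inverse (S p) (w p)) p₀ := by
    have := ((ContinuousLinearMap.id ℝ (V →L[ℝ] V)).analyticAt_bilinear
        (Ring.inverse (S p₀), w p₀)).comp₂ hinv hw
    simpa using this
  have hm : AnalyticAt ℝ (fun p => ⟪T p b, b⟫_ℝ - ⟪Ring.inverse (S p) (w p), w p⟫_ℝ) p₀ := by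
    apply AnalyticAt.sub
    · have := ((innerSL ℝ (E := H)).analyticAt_bilinear (T p₀ b, b)).comp₂ hTb analyticAt_const
      exact this.congr (.of_forall fun _ => rfl)
    · have := ((innerSL ℝ (E := V)).analyticAt_bilinear
        (Ring.inverse (S p₀) (w p₀), w p₀)).comp₂ hRw hw
      exact this.congr (.of_forall fun _ => rfl)
  have hev := eventually_coercive T p₀ hT.continuousAt hc hco
  refine hm.congr ?_
  filter_upwards [hev] with p hp
  exact (sInf_quadratic_eq K V K.le_topologicalClosure (fun _ h => h) (T p) (hsym p)
    (half_pos hc) hp b).symm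

end Literature.Analysis.OperatorTheory
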